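import Literature.NumberTheory.EllipticCurves.BurungaleSkinner2023.RationalThreeTorsionEngineProofs
import HarnessLib

/-!
# Burungale–Skinner 2023, Example (E3), part II: the conductors `35`, `38`
# (curve-side hypotheses of Thm. 2.8 KERNEL-CHECKED; Thms. 2.9 / 3.2 / 3.5 modulo the named facts)

A. Burungale, C. Skinner, Proc. AMS Ser. B 10 (2023), p. 22, Example (E3): "The elliptic curves
26.a2, 34.a3, 35.a2, 38.a2, 44.a2, 50.a2, 106c2 also have rational `3`-torsion points and satisfy the
hypotheses of Theorem 2.8." The curve-side hypotheses of Thm. 2.8 (`p = 3`) are those of Thm. 2.9: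
`3 ∤ N`, a rational subgroup `Φ` of order `3` with `ϕ` even and unramified at `3`, and a prime
`ℓ₀ ∣ N` with `r_{ℓ₀} = 1` (`ℓ₀ ≡ −1 mod 3` if additive). They depend only on the isogeny class and a
rational point of order `3`; this file certifies them — via the engine
`RationalThreeTorsionEngineProofs` (decidable data: `3 ∤ Δ`, `ℓ₀ ∣ Δ`, `ℓ₀ ∤ c₄`, `r_{ℓ₀} = 1`, a
rational `T` with `2T = −T`) — for Cremona's first curve of the SEMISTABLE classes of conductor
`35` and `38` of (E3) (LMFDB class `35.a` = Cremona `35a`, the only class of conductor `35`; `38.a` =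
Cremona `38a`, the class `38b` having `|E(ℚ)_{tors}| ∈ {5, 1}`; the LMFDB numbering of the curves
inside a class differs from Cremona's, and Thm. 2.8's hypotheses are insensitive to the choice of the
curve carrying the rational `3`-torsion point):

* `35.a`: `35A1 = [0,1,1,9,1]`, `Δ = −5³·7³`, `N = 35`, `T = (1,3)`, `ℓ₀ = 7` (`r₇ = 1`; `r₅ = 1` too);
* `38.a`: `38A1 = [1,0,1,9,90]`, `Δ = −2⁹·19³`, `N = 38`, `T = (0,9)`, `ℓ₀ = 2`.

For each curve `c`: `posProportion_twists_c` / `infinitelyMany_twists_c` (Thm. 2.9 modulo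
`thm29_posProportion_twists_rankOne_nondegenerate`: a positive proportion of — so infinitely many —
imaginary quadratic twists with `rank = ord_{s=1} L = 1`, `λ = 1` and NON-DEGENERATE `3`-adic height),
`infinitelyMany_twists_c_pPartBSD` (Thm. 3.2 modulo `thm32_…`),
`infinitelyMany_evenTwists_c_pPartBSD_rankZero` (Thm. 3.5 modulo `thm35_…`). Definitions with bodies
(the models and the points) + theorems; no new facts. Part I: `26`, `34`; part III: `44`, `50`,
`106`; (E2): `20.a3`.

References: [BurungaleSkinner2023] Example (E3) (p. 22), Thms. 2.8/2.9 (pp. 20–21), 3.2 (p. 25), 3.5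
(p. 27); [CremonaAlgorithms1997] Table 1, `N = 35, 38`; [SilvermanAEC2009] VII.1 Rem. 1.1,
VII.5 Prop. 5.1; [Silverman1994] IV.10.2.
-/

noncomputable section

open scoped Classical

open NumberField IsDedekindDomain IsDedekindDomain.HeightOneSpectrum WeierstrassCurve Polynomial
  Literature.NumberTheory.EllipticCurves Literature.NumberTheory.EllipticCurves.Rank1Residual
  Literature.NumberTheory.QuadraticFields.Quadratic

namespace Literature.NumberTheory.EllipticCurves.BurungaleSkinner2023

/-! ### `35.a`: Cremona `35A1 = [0, 1, 1, 9, 1]` -/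

section C35

/-- Cremona `35A1 = [0,1,1,9,1]`, integer model (class `35.a` of (E3)).
[cite: CremonaAlgorithms1997, Table 1, N = 35, curve A1] -/
abbrev M35a1 : WeierstrassCurve ℤ := ⟨0, 1, 1, 9, 1⟩

/-- `35A1 / ℚ`. [cite: CremonaAlgorithms1997, Table 1, N = 35, curve A1] -/
abbrev c35a1 : WeierstrassCurve ℚ := M35a1.baseChange ℚ

/-- `Δ(35A1) = −42875 = −5³·7³`. [cite: CremonaAlgorithms1997, Table 1, N = 35] -/
theorem M35a1_Δ : M35a1.Δ = -42875 := by decide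

/-- `c₄(35A1) = −416 = −2⁵·13`. [cite: CremonaAlgorithms1997, Table 1, N = 35] -/
theorem M35a1_c₄ : M35a1.c₄ = -416 := by decide

/-- `35A1` is an elliptic curve. [cite: CremonaAlgorithms1997, Table 1, N = 35] -/
theorem isElliptic_c35a1 : c35a1.IsElliptic := by
  rw [WeierstrassCurve.isElliptic_iff, baseChange_int_Δ, M35a1_Δ]; norm_num

/-- `35A1` is a global minimal equation. [cite: SilvermanAEC2009, VII.1 Remark 1.1] -/
theorem isGloballyMinimal_c35a1 : c35a1.IsGloballyMinimal :=
  isGloballyMinimal_baseChange_int M35a1 (forall_not_pow_dvd_or_of_bound M35a1 (B := 3)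
    (by rw [M35a1_Δ]; decide) (by rw [M35a1_Δ]; decide) (by rw [M35a1_Δ, M35a1_c₄]; decide))

/-- **`N(35A1) = 35`.** [cite: CremonaAlgorithms1997, Table 1, N = 35] -/
theorem conductorNorm_c35a1 : c35a1.conductorNorm ℤ = 35 := by
  haveI := isElliptic_c35a1
  refine conductorNorm_baseChange_int_of_isCoprime M35a1
    (by rw [M35a1_Δ, M35a1_c₄, Int.isCoprime_iff_gcd_eq_one]; decide) (k := 3) ?_ ?_ ?_
  · rw [Nat.squarefree_iff_nodup_primeFactorsList (by norm_num)]; simp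
  · rw [M35a1_Δ]; decide
  · rw [M35a1_Δ]; decide

/-- The coefficients of `35A1 / ℚ`. [cite: CremonaAlgorithms1997, Table 1, N = 35] -/
theorem c35a1_eq : c35a1 = ⟨0, 1, 1, 9, 1⟩ := by
  ext <;> simp [WeierstrassCurve.baseChange, WeierstrassCurve.map]

/-- The rational `3`-torsion point `T = (1, 3)` of `35A1` (`|E(ℚ)_{tors}| = 3`).
[cite: CremonaAlgorithms1997, Table 1, N = 35, curve A1 (|T| = 3)] -/
def T35a1 : c35a1.toAffine.Point :=
  Affine.Point.some 1 3 ((Affine.nonsingular_iff' _ _).mpr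
    ⟨(Affine.equation_iff _ _).mpr (by rw [c35a1_eq]; norm_num), Or.inr (by rw [c35a1_eq]; norm_num)⟩)

/-- `T + T = −T` on `35A1` (tangent slope `2` at `(1,3)`). [cite: CremonaAlgorithms1997, Table 1, N = 35] -/
theorem T35a1_add_self [DecidableEq ℚ] : T35a1 + T35a1 = -T35a1 := by
  have hy : (3 : ℚ) ≠ c35a1.toAffine.negY 1 3 := by rw [c35a1_eq]; norm_num [Affine.negY]
  unfold T35a1
  rw [Affine.Point.add_self_of_Y_ne hy, Affine.Point.neg_some]
  congr 1
  · rw [Affine.slope_of_Y_ne rfl hy, c35a1_eq]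
    norm_num [Affine.addX, Affine.negY]
  · rw [Affine.slope_of_Y_ne rfl hy, c35a1_eq]
    norm_num [Affine.addY, Affine.negAddY, Affine.addX, Affine.negY]

/-- `3·T̄ = O` in `E(ℚ̄)` for `35A1`. [cite: CremonaAlgorithms1997, Table 1, N = 35, curve A1 (|T| = 3)] -/
theorem three_nsmul_toGeomPoints_T35a1 : (3 : ℕ) • toGeomPoints c35a1 T35a1 = 0 := by
  have h3 : ∀ [DecidableEq ℚ], (3 : ℕ) • T35a1 = 0 := fun {_} => by
    rw [show (3 : ℕ) = 2 + 1 from rfl, add_nsmul, two_nsmul, one_nsmul, T35a1_add_self,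
      neg_add_cancel]
  have h := map_nsmul (Affine.Point.map (W' := c35a1.toAffine) (S := ℚ)
    (Algebra.ofId ℚ (AlgebraicClosure ℚ))) 3 T35a1
  rw [h3, map_zero] at h
  exact h.symm

/-- **Thm. 2.9 for `35.a` (`35A1`, `ℓ₀ = 7`, `r₇ = 1`)**, modulo
`thm29_posProportion_twists_rankOne_nondegenerate`. [cite: BurungaleSkinner2023, Thm. 2.9 (p. 21) with Example (E3) (p. 22)] -/
theorem posProportion_twists_c35a1 [Fact (Nat.Prime 7)]
    (h : thm29_posProportion_twists_rankOne_nondegenerate) :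
    haveI := isElliptic_c35a1
    haveI := isGloballyMinimal_c35a1
    OddQuadraticCharPosProportion fun d ↦ TwistConclusion c35a1 3 d := by
  haveI := isElliptic_c35a1
  haveI := isGloballyMinimal_c35a1
  exact posProportion_twists_of_intModel M35a1 (ℓ₀ := 7) (by rw [M35a1_Δ]; decide)
    (by rw [M35a1_Δ]; decide) (by rw [M35a1_Δ]; decide) (by rw [M35a1_Δ]; decide)
    numPrimesAbove_three_seven (fun hc => absurd hc (by rw [M35a1_c₄]; decide)) T35a1
    (Affine.Point.some_ne_zero _) three_nsmul_toGeomPoints_T35a1 h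

/-- **Infinitely many rank-one twists of `35A1` with non-degenerate `3`-adic height**, modulo Thm.
2.9 by name. [cite: BurungaleSkinner2023, Thm. 2.9 (p. 21) with Example (E3) (p. 22)] -/
theorem infinitelyMany_twists_c35a1 [Fact (Nat.Prime 7)]
    (h : thm29_posProportion_twists_rankOne_nondegenerate) :
    haveI := isElliptic_c35a1
    haveI := isGloballyMinimal_c35a1
    {d : ℤ | IsOddQuadraticCharDiscr d ∧ TwistConclusion c35a1 3 d}.Infinite :=
  (posProportion_twists_c35a1 h).infinite

/-- **Thm. 3.2 for `35.a`**, modulo `thm32_posProportion_twists_pPartBSD`.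
[cite: BurungaleSkinner2023, Thm. 3.2 (p. 25) with Example (E3) (p. 22)] -/
theorem infinitelyMany_twists_c35a1_pPartBSD [Fact (Nat.Prime 7)]
    (h : thm32_posProportion_twists_pPartBSD) :
    haveI := isElliptic_c35a1
    haveI := isGloballyMinimal_c35a1
    {d : ℤ | IsOddQuadraticCharDiscr d ∧ ((c35a1.quadraticTwist (d : ℚ)).analyticRank = 1 ∧
      ∀ (W' : WeierstrassCurve ℚ) [W'.IsElliptic] [W'.IsGloballyMinimal] (C : VariableChange ℚ),
        C • c35a1.quadraticTwist (d : ℚ) = W' → PPartRankOnePrintShape W' 3)}.Infinite := by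
  haveI := isElliptic_c35a1
  haveI := isGloballyMinimal_c35a1
  exact infinitelyMany_twists_pPartBSD_of_intModel M35a1 (ℓ₀ := 7) (by rw [M35a1_Δ]; decide)
    (by rw [M35a1_Δ]; decide) (by rw [M35a1_Δ]; decide) (by rw [M35a1_Δ]; decide)
    numPrimesAbove_three_seven (fun hc => absurd hc (by rw [M35a1_c₄]; decide)) T35a1
    (Affine.Point.some_ne_zero _) three_nsmul_toGeomPoints_T35a1 h

/-- **Thm. 3.5 for `35.a`**, modulo `thm35_posProportion_evenTwists_pPartBSD_rankZero`.
[cite: BurungaleSkinner2023, Thm. 3.5 (p. 27) with Example (E3) (p. 22)] -/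
theorem infinitelyMany_evenTwists_c35a1_pPartBSD_rankZero [Fact (Nat.Prime 7)]
    (h : thm35_posProportion_evenTwists_pPartBSD_rankZero) :
    haveI := isElliptic_c35a1
    haveI := isGloballyMinimal_c35a1
    {d : ℤ | IsEvenQuadraticCharDiscr d ∧ ((c35a1.quadraticTwist (d : ℚ)).entireLFunction 1 ≠ 0 ∧
      ∀ (W' : WeierstrassCurve ℚ) [W'.IsElliptic] [W'.IsGloballyMinimal] (C : VariableChange ℚ),
        C • c35a1.quadraticTwist (d : ℚ) = W' → PPartRankZeroPrintShape W' 3)}.Infinite := by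
  haveI := isElliptic_c35a1
  haveI := isGloballyMinimal_c35a1
  exact infinitelyMany_evenTwists_pPartBSD_rankZero_of_intModel M35a1 (ℓ₀ := 7)
    (by rw [M35a1_Δ]; decide) (by rw [M35a1_Δ]; decide) (by rw [M35a1_Δ]; decide)
    (by rw [M35a1_Δ]; decide) numPrimesAbove_three_seven
    (fun hc => absurd hc (by rw [M35a1_c₄]; decide)) T35a1 (Affine.Point.some_ne_zero _)
    three_nsmul_toGeomPoints_T35a1 h

end C35

/-! ### `38.a`: Cremona `38A1 = [1, 0, 1, 9, 90]` -/

section C38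

/-- Cremona `38A1 = [1,0,1,9,90]`, integer model (class `38.a` of (E3); `38.b` has `|T| = 5`).
[cite: CremonaAlgorithms1997, Table 1, N = 38, curve A1] -/
abbrev M38a1 : WeierstrassCurve ℤ := ⟨1, 0, 1, 9, 90⟩

/-- `38A1 / ℚ`. [cite: CremonaAlgorithms1997, Table 1, N = 38, curve A1] -/
abbrev c38a1 : WeierstrassCurve ℚ := M38a1.baseChange ℚ

/-- `Δ(38A1) = −3511808 = −2⁹·19³`. [cite: CremonaAlgorithms1997, Table 1, N = 38] -/
theorem M38a1_Δ : M38a1.Δ = -3511808 := by decide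

/-- `c₄(38A1) = −455 = −5·7·13`. [cite: CremonaAlgorithms1997, Table 1, N = 38] -/
theorem M38a1_c₄ : M38a1.c₄ = -455 := by decide

/-- `38A1` is an elliptic curve. [cite: CremonaAlgorithms1997, Table 1, N = 38] -/
theorem isElliptic_c38a1 : c38a1.IsElliptic := by
  rw [WeierstrassCurve.isElliptic_iff, baseChange_int_Δ, M38a1_Δ]; norm_num

/-- `38A1` is a global minimal equation (`|Δ| < 4¹²`, `2¹² ∤ Δ`, `3 ∤ Δ`).
[cite: SilvermanAEC2009, VII.1 Remark 1.1] -/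
theorem isGloballyMinimal_c38a1 : c38a1.IsGloballyMinimal :=
  isGloballyMinimal_baseChange_int M38a1 (forall_not_pow_dvd_or_of_bound M38a1 (B := 4)
    (by rw [M38a1_Δ]; decide) (by rw [M38a1_Δ]; decide) (by rw [M38a1_Δ, M38a1_c₄]; decide))

/-- **`N(38A1) = 38`.** [cite: CremonaAlgorithms1997, Table 1, N = 38] -/
theorem conductorNorm_c38a1 : c38a1.conductorNorm ℤ = 38 := by
  haveI := isElliptic_c38a1
  refine conductorNorm_baseChange_int_of_isCoprime M38a1
    (by rw [M38a1_Δ, M38a1_c₄, Int.isCoprime_iff_gcd_eq_one]; decide) (k := 9) ?_ ?_ ?_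
  · rw [Nat.squarefree_iff_nodup_primeFactorsList (by norm_num)]; simp
  · rw [M38a1_Δ]; decide
  · rw [M38a1_Δ]; decide

/-- The coefficients of `38A1 / ℚ`. [cite: CremonaAlgorithms1997, Table 1, N = 38] -/
theorem c38a1_eq : c38a1 = ⟨1, 0, 1, 9, 90⟩ := by
  ext <;> simp [WeierstrassCurve.baseChange, WeierstrassCurve.map]

/-- The rational `3`-torsion point `T = (0, 9)` of `38A1` (`|E(ℚ)_{tors}| = 3`).
[cite: CremonaAlgorithms1997, Table 1, N = 38, curve A1 (|T| = 3)] -/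
def T38a1 : c38a1.toAffine.Point :=
  Affine.Point.some 0 9 ((Affine.nonsingular_iff' _ _).mpr
    ⟨(Affine.equation_iff _ _).mpr (by rw [c38a1_eq]; norm_num), Or.inr (by rw [c38a1_eq]; norm_num)⟩)

/-- `T + T = −T` on `38A1` (horizontal tangent at `(0,9)`). [cite: CremonaAlgorithms1997, Table 1, N = 38] -/
theorem T38a1_add_self [DecidableEq ℚ] : T38a1 + T38a1 = -T38a1 := by
  have hy : (9 : ℚ) ≠ c38a1.toAffine.negY 0 9 := by rw [c38a1_eq]; norm_num [Affine.negY]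
  unfold T38a1
  rw [Affine.Point.add_self_of_Y_ne hy, Affine.Point.neg_some]
  congr 1
  · rw [Affine.slope_of_Y_ne rfl hy, c38a1_eq]
    norm_num [Affine.addX, Affine.negY]
  · rw [Affine.slope_of_Y_ne rfl hy, c38a1_eq]
    norm_num [Affine.addY, Affine.negAddY, Affine.addX, Affine.negY]

/-- `3·T̄ = O` in `E(ℚ̄)` for `38A1`. [cite: CremonaAlgorithms1997, Table 1, N = 38, curve A1 (|T| = 3)] -/
theorem three_nsmul_toGeomPoints_T38a1 : (3 : ℕ) • toGeomPoints c38a1 T38a1 = 0 := by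
  have h3 : ∀ [DecidableEq ℚ], (3 : ℕ) • T38a1 = 0 := fun {_} => by
    rw [show (3 : ℕ) = 2 + 1 from rfl, add_nsmul, two_nsmul, one_nsmul, T38a1_add_self,
      neg_add_cancel]
  have h := map_nsmul (Affine.Point.map (W' := c38a1.toAffine) (S := ℚ)
    (Algebra.ofId ℚ (AlgebraicClosure ℚ))) 3 T38a1
  rw [h3, map_zero] at h
  exact h.symm

/-- **Thm. 2.9 for `38.a` (`38A1`, `ℓ₀ = 2`)**, modulo `thm29_posProportion_twists_rankOne_nondegenerate`.
[cite: BurungaleSkinner2023, Thm. 2.9 (p. 21) with Example (E3) (p. 22)] -/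
theorem posProportion_twists_c38a1 (h : thm29_posProportion_twists_rankOne_nondegenerate) :
    haveI := isElliptic_c38a1
    haveI := isGloballyMinimal_c38a1
    OddQuadraticCharPosProportion fun d ↦ TwistConclusion c38a1 3 d := by
  haveI := isElliptic_c38a1
  haveI := isGloballyMinimal_c38a1
  exact posProportion_twists_of_intModel M38a1 (ℓ₀ := 2) (by rw [M38a1_Δ]; decide)
    (by rw [M38a1_Δ]; decide) (by rw [M38a1_Δ]; decide) (by rw [M38a1_Δ]; decide)
    numPrimesAbove_three_two (fun _ => by decide) T38a1 (Affine.Point.some_ne_zero _)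
    three_nsmul_toGeomPoints_T38a1 h

/-- **Infinitely many rank-one twists of `38A1` with non-degenerate `3`-adic height**, modulo Thm.
2.9 by name. [cite: BurungaleSkinner2023, Thm. 2.9 (p. 21) with Example (E3) (p. 22)] -/
theorem infinitelyMany_twists_c38a1 (h : thm29_posProportion_twists_rankOne_nondegenerate) :
    haveI := isElliptic_c38a1
    haveI := isGloballyMinimal_c38a1
    {d : ℤ | IsOddQuadraticCharDiscr d ∧ TwistConclusion c38a1 3 d}.Infinite :=
  (posProportion_twists_c38a1 h).infinite

/-- **Thm. 3.2 for `38.a`**, modulo `thm32_posProportion_twists_pPartBSD`.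
[cite: BurungaleSkinner2023, Thm. 3.2 (p. 25) with Example (E3) (p. 22)] -/
theorem infinitelyMany_twists_c38a1_pPartBSD (h : thm32_posProportion_twists_pPartBSD) :
    haveI := isElliptic_c38a1
    haveI := isGloballyMinimal_c38a1
    {d : ℤ | IsOddQuadraticCharDiscr d ∧ ((c38a1.quadraticTwist (d : ℚ)).analyticRank = 1 ∧
      ∀ (W' : WeierstrassCurve ℚ) [W'.IsElliptic] [W'.IsGloballyMinimal] (C : VariableChange ℚ),
        C • c38a1.quadraticTwist (d : ℚ) = W' → PPartRankOnePrintShape W' 3)}.Infinite := by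
  haveI := isElliptic_c38a1
  haveI := isGloballyMinimal_c38a1
  exact infinitelyMany_twists_pPartBSD_of_intModel M38a1 (ℓ₀ := 2) (by rw [M38a1_Δ]; decide)
    (by rw [M38a1_Δ]; decide) (by rw [M38a1_Δ]; decide) (by rw [M38a1_Δ]; decide)
    numPrimesAbove_three_two (fun _ => by decide) T38a1 (Affine.Point.some_ne_zero _)
    three_nsmul_toGeomPoints_T38a1 h

/-- **Thm. 3.5 for `38.a`**, modulo `thm35_posProportion_evenTwists_pPartBSD_rankZero`.
[cite: BurungaleSkinner2023, Thm. 3.5 (p. 27) with Example (E3) (p. 22)] -/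
theorem infinitelyMany_evenTwists_c38a1_pPartBSD_rankZero
    (h : thm35_posProportion_evenTwists_pPartBSD_rankZero) :
    haveI := isElliptic_c38a1
    haveI := isGloballyMinimal_c38a1
    {d : ℤ | IsEvenQuadraticCharDiscr d ∧ ((c38a1.quadraticTwist (d : ℚ)).entireLFunction 1 ≠ 0 ∧
      ∀ (W' : WeierstrassCurve ℚ) [W'.IsElliptic] [W'.IsGloballyMinimal] (C : VariableChange ℚ),
        C • c38a1.quadraticTwist (d : ℚ) = W' → PPartRankZeroPrintShape W' 3)}.Infinite := by
  haveI := isElliptic_c38a1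
  haveI := isGloballyMinimal_c38a1
  exact infinitelyMany_evenTwists_pPartBSD_rankZero_of_intModel M38a1 (ℓ₀ := 2)
    (by rw [M38a1_Δ]; decide) (by rw [M38a1_Δ]; decide) (by rw [M38a1_Δ]; decide)
    (by rw [M38a1_Δ]; decide) numPrimesAbove_three_two (fun _ => by decide) T38a1
    (Affine.Point.some_ne_zero _) three_nsmul_toGeomPoints_T38a1 h

end C38

end Literature.NumberTheory.EllipticCurves.BurungaleSkinner2023

end
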